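import Mathlib.CategoryTheory.Limits.FullSubcategory
import Literature.AnabelianGeometry.Anabelioids.ProSigmaProofs
import Literature.AnabelianGeometry.Anabelioids.GaloisFiniteColimits
import Literature.AnabelianGeometry.Anabelioids.ExactFunctorProofs
import Literature.AnabelianGeometry.Anabelioids.AutOfEquivalence

/-!
# The pro-`Σ` completion is functorial in morphisms of connected anabelioids ([SemiAnbd] Def. 2.9 (ii))

Mochizuki, *Semi-graphs of anabelioids*, Publ. RIMS **42** (2006) 221–322, §2, Definition 2.9 (ii),
author's manuscript p. 31 [cite: MochizukiSemiAnbd2006, Def. 2.9(ii) p.31]: "we shall refer to as the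
*pro-`Σ` completion* of `A` the connected anabelioid constituted by the full subcategory of `A`
determined by the objects dominated by a Galois covering of the final object of `A` whose degree is a
`Σ`-integer.  Similarly, given a semi-graph of anabelioids, we shall refer to as the pro-`Σ`
completion of the given semi-graph of anabelioids the semi-graph of anabelioids obtained by replacing
each constituent anabelioid by its pro-`Σ` completion."  The second sentence tacitly uses that a
morphism of connected anabelioids `φ : X → Y` (an exact functor `φ^* : Y ⥤ X`, [GeoAn] Def. 1.1.2)
RESTRICTS to the completions: `φ^*` carries `Σ`-dominated objects to `Σ`-dominated objects, and the
restricted functor `Y^Σ ⥤ X^Σ` is again exact.  This file (abc-iut cell, layer L3; the object-level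
completion `ProSigmaCompletion` and the fact that it is a Galois category are `ProSigma.lean` /
`ProSigmaProofs.lean`) supplies exactly that:

* `proSigmaObj_iff_exists_openNormal` — the dictionary of `ProSigmaProofs.lean` packaged: `X` is
  `Σ`-dominated iff some open normal subgroup of `Aut F` of `Σ`-index acts trivially on `F(X)`;
* `isClosedUnderLimitsOfShape_proSigmaObj`, `isClosedUnderColimitsOfShape_proSigmaObj` (finite
  shapes), `preservesFiniteLimits_proSigmaι`, `preservesFiniteColimits_proSigmaι` — the inclusion
  `X^Σ ⥤ X` is exact, i.e. a morphism of anabelioids `X → X^Σ` (`Hom.toProSigma`);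
* `proSigmaObj_obj_of_exact` — an exact functor between Galois categories preserves `Σ`-domination
  (the preimage of a `Σ`-index open normal subgroup under `π₁(φ)` has `Σ`-index);
* `Hom.proSigmaRestrict φ Σ : Hom X^Σ Y^Σ` — the restriction, with `ι_Y ⋙ φ^* = (φ^Σ)^* ⋙ ι_X`
  definitionally (`Hom.proSigmaRestrict_pullback_comp_ι`).
-/

namespace Literature.AnabelianGeometry.Anabelioids

open CategoryTheory CategoryTheory.Limits CategoryTheory.PreGaloisCategory

universe v₁ v₂ u₁ u₂

section OneCategory

variable {X : Type u₁} [Category.{v₁} X] [GaloisCategory X] (Sigma : Set ℕ)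

/-- The dictionary of `ProSigmaProofs.lean`, packaged: an object is dominated by a Galois object with
`Σ`-automorphism group iff some open normal subgroup of `Aut F` of `Σ`-index acts trivially on its
fibre. [cite: MochizukiSemiAnbd2006, Def. 2.9(ii) p.31] -/
theorem proSigmaObj_iff_exists_openNormal (F : X ⥤ FintypeCat.{u₁}) [FiberFunctor F] (A : X) :
    proSigmaObj Sigma A ↔ ∃ U : OpenSubgroup (Aut F), U.toSubgroup.Normal ∧
      IsSigmaInteger Sigma U.toSubgroup.index ∧ ∀ σ ∈ U, σ.hom.app A = 𝟙 _ :=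
  ⟨exists_openNormal_of_proSigmaObj F,
    fun ⟨U, hUn, hSig, htriv⟩ => proSigmaObj_of_openNormal F U hUn hSig htriv⟩

/-- A finite family of `Σ`-dominated objects is dominated through ONE open normal subgroup of
`Σ`-index (intersect). [cite: MochizukiSemiAnbd2006, Def. 2.9(ii) p.31] -/
theorem exists_openNormal_forall_of_proSigmaObj (F : X ⥤ FintypeCat.{u₁}) [FiberFunctor F]
    {ι : Type} [Finite ι] (A : ι → X) (hA : ∀ i, proSigmaObj Sigma (A i)) :
    ∃ V : OpenSubgroup (Aut F), V.toSubgroup.Normal ∧ IsSigmaInteger Sigma V.toSubgroup.index ∧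
      ∀ i, ∀ σ ∈ V, σ.hom.app (A i) = 𝟙 _ := by
  classical
  haveI := Fintype.ofFinite ι
  choose U hUn hUS hUtriv using fun i => exists_openNormal_of_proSigmaObj F (hA i)
  obtain ⟨V, hVn, hVS, hV⟩ := exists_openNormal_le_finset U hUn hUS Finset.univ
  exact ⟨V, hVn, hVS, fun i σ hσ => hUtriv i σ (hV i (Finset.mem_univ i) hσ)⟩

/-- `Σ`-domination passes to subobjects. [cite: MochizukiSemiAnbd2006, Def. 2.9(ii) p.31] -/
theorem proSigmaObj_of_mono {A B : X} (i : A ⟶ B) [Mono i] (hB : proSigmaObj Sigma B) :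
    proSigmaObj Sigma A := by
  let F : X ⥤ FintypeCat.{u₁} := GaloisCategory.getFiberFunctor X ⋙ FintypeCat.uSwitch.{v₁, u₁}
  haveI : FiberFunctor F := FiberFunctor.comp_right _
  obtain ⟨U, hUn, hSig, htriv⟩ := exists_openNormal_of_proSigmaObj F hB
  exact proSigmaObj_of_openNormal F U hUn hSig fun σ hσ => app_eq_id_of_injective F i
    (ConcreteCategory.injective_of_mono_of_preservesPullback (F.map i)) σ (htriv σ hσ)

/-- `Σ`-domination passes to quotients. [cite: MochizukiSemiAnbd2006, Def. 2.9(ii) p.31] -/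
theorem proSigmaObj_of_epi {A B : X} (f : A ⟶ B) [Epi f] (hA : proSigmaObj Sigma A) :
    proSigmaObj Sigma B := by
  let F : X ⥤ FintypeCat.{u₁} := GaloisCategory.getFiberFunctor X ⋙ FintypeCat.uSwitch.{v₁, u₁}
  haveI : FiberFunctor F := FiberFunctor.comp_right _
  obtain ⟨U, hUn, hSig, htriv⟩ := exists_openNormal_of_proSigmaObj F hA
  exact proSigmaObj_of_openNormal F U hUn hSig fun σ hσ =>
    app_eq_id_of_surjective F f (surjective_on_fiber_of_epi F f) σ (htriv σ hσ)

/-- **The pro-`Σ` objects are closed under finite limits.** [cite: MochizukiSemiAnbd2006, Def. 2.9(ii) p.31] -/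
theorem isClosedUnderLimitsOfShape_proSigmaObj (J : Type) [SmallCategory J] [FinCategory J] :
    (proSigmaObj (A := X) Sigma).IsClosedUnderLimitsOfShape J := by
  let F : X ⥤ FintypeCat.{u₁} := GaloisCategory.getFiberFunctor X ⋙ FintypeCat.uSwitch.{v₁, u₁}
  haveI : FiberFunctor F := FiberFunctor.comp_right _
  refine ⟨fun A hA => ?_⟩
  obtain ⟨p⟩ := hA
  obtain ⟨V, hVn, hVS, hV⟩ :=
    exists_openNormal_forall_of_proSigmaObj Sigma F (fun j : J => p.diag.obj j) p.prop_diag_obj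
  exact proSigmaObj_of_openNormal F V hVn hVS fun σ hσ =>
    app_eq_id_of_isLimit F (Cone.mk A p.π) p.isLimit σ (fun j => hV j σ hσ)

/-- **The pro-`Σ` objects are closed under finite colimits** (a finite colimit is a quotient of the
finite coproduct, which is dominated through the intersection of finitely many open subgroups).
[cite: MochizukiSemiAnbd2006, Def. 2.9(ii) p.31] -/
theorem isClosedUnderColimitsOfShape_proSigmaObj (J : Type) [SmallCategory J] [FinCategory J] :
    (proSigmaObj (A := X) Sigma).IsClosedUnderColimitsOfShape J := by
  let F : X ⥤ FintypeCat.{u₁} := GaloisCategory.getFiberFunctor X ⋙ FintypeCat.uSwitch.{v₁, u₁}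
  haveI : FiberFunctor F := FiberFunctor.comp_right _
  refine ⟨fun A hA => ?_⟩
  obtain ⟨p⟩ := hA
  -- the coproduct of the objects of the diagram is `Σ`-dominated
  have hcop : proSigmaObj Sigma (∐ p.diag.obj) := by
    obtain ⟨V, hVn, hVS, hV⟩ :=
      exists_openNormal_forall_of_proSigmaObj Sigma F (fun j : J => p.diag.obj j) p.prop_diag_obj
    exact proSigmaObj_of_openNormal F V hVn hVS fun σ hσ =>
      app_eq_id_of_isColimit F _ (coproductIsCoproduct p.diag.obj) σ (fun j => hV j.1 σ hσ)
  -- and the colimit is its quotient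
  let e : ∐ p.diag.obj ⟶ A := Limits.Sigma.desc fun j => p.ι.app j
  haveI : Epi e := ⟨fun u v huv => p.isColimit.hom_ext fun j => by
    have h := congrArg (Limits.Sigma.ι p.diag.obj j ≫ ·) huv
    simp only [e, Limits.Sigma.ι_desc_assoc] at h
    exact h⟩
  exact proSigmaObj_of_epi Sigma e hcop

/-- The inclusion `X^Σ ⥤ X` preserves finite limits (it creates them).
[cite: MochizukiSemiAnbd2006, Def. 2.9(ii) p.31] -/
theorem preservesFiniteLimits_proSigmaι : PreservesFiniteLimits (proSigmaObj (A := X) Sigma).ι := by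
  refine ⟨fun J _ _ => ?_⟩
  haveI := isClosedUnderLimitsOfShape_proSigmaObj (X := X) Sigma J
  infer_instance

/-- The inclusion `X^Σ ⥤ X` preserves finite colimits (it creates them; a Galois category has finite
colimits). [cite: MochizukiSemiAnbd2006, Def. 2.9(ii) p.31] -/
theorem preservesFiniteColimits_proSigmaι :
    PreservesFiniteColimits (proSigmaObj (A := X) Sigma).ι := by
  refine ⟨fun J _ _ => ?_⟩
  haveI := isClosedUnderColimitsOfShape_proSigmaObj (X := X) Sigma J
  haveI : HasColimitsOfShape J X := hasColimitsOfShape_of_galoisCategory X J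
  infer_instance

variable (X) in
/-- The morphism of anabelioids `X → X^Σ` to the pro-`Σ` completion: its pull-back functor is the
(exact) inclusion of the full subcategory. [cite: MochizukiSemiAnbd2006, Def. 2.9(ii) p.31] -/
noncomputable def Hom.toProSigma : Hom X (ProSigmaCompletion X Sigma) :=
  haveI := preservesFiniteLimits_proSigmaι (X := X) Sigma
  haveI := preservesFiniteColimits_proSigmaι (X := X) Sigma
  ExactFunctor.of (proSigmaObj (A := X) Sigma).ι

/-- The pull-back functor of `X → X^Σ` is the inclusion. [cite: MochizukiSemiAnbd2006, Def. 2.9(ii) p.31] -/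
theorem Hom.toProSigma_pullback :
    (Hom.toProSigma X Sigma).pullback = (proSigmaObj (A := X) Sigma).ι := rfl

end OneCategory

section Restrict

variable {X : Type u₁} [Category.{v₁} X] [GaloisCategory X] {Y : Type u₂} [Category.{v₂} Y]
  [GaloisCategory Y] (Sigma : Set ℕ)

/-- **An exact functor between Galois categories preserves `Σ`-domination**: if `B ∈ Y` is
dominated by a Galois object with `Σ`-automorphism group, so is `P B ∈ X` — the preimage under
`π₁(P) : Aut F → Aut (P ⋙ F)` of a `Σ`-index open normal subgroup acting trivially on `F(P B)` is an
open normal subgroup of `Σ`-index (its index divides the former).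
[cite: MochizukiSemiAnbd2006, Def. 2.9(ii) p.31] -/
theorem proSigmaObj_obj_of_exact (P : Y ⥤ X) [PreservesFiniteLimits P] [PreservesFiniteColimits P]
    {B : Y} (hB : proSigmaObj Sigma B) : proSigmaObj Sigma (P.obj B) := by
  let F : X ⥤ FintypeCat.{u₁} := GaloisCategory.getFiberFunctor X ⋙ FintypeCat.uSwitch.{v₁, u₁}
  haveI : FiberFunctor F := FiberFunctor.comp_right _
  haveI : FiberFunctor (P ⋙ F) := fiberFunctor_comp_of_exact P F
  obtain ⟨U, hUn, hSig, htriv⟩ := exists_openNormal_of_proSigmaObj (P ⋙ F) hB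
  let θ : Aut F →* Aut (P ⋙ F) := pi1Map P F
  have hθ : Continuous θ := continuous_pi1Map' P F
  let U' : OpenSubgroup (Aut F) := ⟨U.toSubgroup.comap θ, U.isOpen'.preimage hθ⟩
  refine proSigmaObj_of_openNormal F U' (hUn.comap θ) ?_ fun σ hσ => ?_
  · -- the index of the preimage divides the index of `U`
    change IsSigmaInteger Sigma (U.toSubgroup.comap θ).index
    rw [Subgroup.index_comap]
    exact hSig.of_dvd (Subgroup.relIndex_dvd_index_of_normal _ _)
  · have h := htriv (θ σ) hσ
    exact h

/-- **The restriction of a morphism of connected anabelioids to the pro-`Σ` completions**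
([SemiAnbd] Def. 2.9 (ii), implicit in "replacing each constituent anabelioid by its pro-`Σ`
completion"): the exact functor `φ^* : Y ⥤ X` restricts to an exact functor `Y^Σ ⥤ X^Σ`.
[cite: MochizukiSemiAnbd2006, Def. 2.9(ii) p.31] -/
noncomputable def Hom.proSigmaRestrict (φ : Hom X Y) :
    Hom (ProSigmaCompletion X Sigma) (ProSigmaCompletion Y Sigma) := by
  let P' : ProSigmaCompletion Y Sigma ⥤ ProSigmaCompletion X Sigma :=
    (proSigmaObj (A := X) Sigma).lift ((proSigmaObj (A := Y) Sigma).ι ⋙ φ.pullback)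
      fun B => proSigmaObj_obj_of_exact Sigma φ.pullback B.property
  haveI := preservesFiniteLimits_proSigmaι (X := X) Sigma
  haveI := preservesFiniteColimits_proSigmaι (X := X) Sigma
  haveI := preservesFiniteLimits_proSigmaι (X := Y) Sigma
  haveI := preservesFiniteColimits_proSigmaι (X := Y) Sigma
  haveI : PreservesFiniteLimits P' := ⟨fun J _ _ => by
    haveI : PreservesLimitsOfShape J (P' ⋙ (proSigmaObj (A := X) Sigma).ι) :=
      inferInstanceAs (PreservesLimitsOfShape J ((proSigmaObj (A := Y) Sigma).ι ⋙ φ.pullback))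
    exact preservesLimitsOfShape_of_reflects_of_preserves P' (proSigmaObj (A := X) Sigma).ι⟩
  haveI : PreservesFiniteColimits P' := ⟨fun J _ _ => by
    haveI : PreservesColimitsOfShape J (P' ⋙ (proSigmaObj (A := X) Sigma).ι) :=
      inferInstanceAs (PreservesColimitsOfShape J ((proSigmaObj (A := Y) Sigma).ι ⋙ φ.pullback))
    exact preservesColimitsOfShape_of_reflects_of_preserves P' (proSigmaObj (A := X) Sigma).ι⟩
  exact ExactFunctor.of P'

/-- The restriction commutes with the inclusions: `(φ^Σ)^* ⋙ ι_X = ι_Y ⋙ φ^*` (definitionally).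
[cite: MochizukiSemiAnbd2006, Def. 2.9(ii) p.31] -/
theorem Hom.proSigmaRestrict_pullback_comp_ι (φ : Hom X Y) :
    (φ.proSigmaRestrict Sigma).pullback ⋙ (proSigmaObj (A := X) Sigma).ι =
      (proSigmaObj (A := Y) Sigma).ι ⋙ φ.pullback := rfl

/-- On objects, the restriction is `φ^*`. [cite: MochizukiSemiAnbd2006, Def. 2.9(ii) p.31] -/
theorem Hom.proSigmaRestrict_pullback_obj (φ : Hom X Y) (B : ProSigmaCompletion Y Sigma) :
    ((φ.proSigmaRestrict Sigma).pullback.obj B).obj = φ.pullback.obj B.obj := rfl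

end Restrict

end Literature.AnabelianGeometry.Anabelioids
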